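import Summits.Ventures.PercRepro.Night2LineFaces
import Summits.Ventures.PercRepro.Night2NonFatLevelAny

/-!
# night-2: THE LINE THEOREM — the fair share of a lossy basis pair whose `W` sits on a basis line (gen 38)

Let `(B, z)` be a lossy basis pair of the non-fat cell `(2, 1)`, `Q = B ∪ {z}`, `W = G ∖ Q`, and let `a, b ∈ Q′ = Q ∖ K` be two
basis points with the line `ℓ = cl {a, b}`; `D = W ∩ ℓ` (`d = |D|`), `O = W ∖ ℓ`.  Fix `Y_O ⊆ O` with `|Y_O| ≥ 3` and
`rk (O ∖ Y_O) ≤ 1` (`Y_O = O`, or `O` minus one point).  The targets `T = Q ∪ (Y_D ∪ Y_O)`, `Y_D ⊆ D`, `|Y_D| ≥ 5`, are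
* unloaded (`dload_eq_zero_of_line_target`: seven points of `T′` on `ℓ`, six off it),
* of full capacity `vCap T = 1` (`G ∖ T ⊆ (D ∖ Y_D) ∪ (O ∖ Y_O)` has rank `≤ 2 + 1`),
* of face sum `≤ (1/3) · lineFaceBound (|Y_D| + 2) (|Y_O| + 3)` (`faceSum_le_third_mul_lineCount`, `T′ ∩ ℓ = {a, b} ∪ Y_D`,
  `T′ ∖ ℓ = (Q′ ∖ ℓ) ∪ Y_O` with `|Q′ ∖ ℓ| = 3`).
**`basis_pair_fair_of_line`**: the pair is fair as soon as
`1 ≤ Σ_{j=5}^{d} C(d, j) · 3 / lineFaceBound (j + 2) (|Y_O| + 3)` (the sum over `Y_D` regrouped by `|Y_D|`,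
`Finset.sum_powerset_apply_card`).  Numerically the condition holds e.g. for `d ≥ 9, |Y_O| = 3` (`1.41`), for `d ≥ 10` and
`|Y_O| ≤ 5`, for `d ≥ 12` and `|Y_O| ≤ 9`.  Paper: proofs/NIGHT-2-g38.md §3.
-/

namespace PercRepro.Shadow

open PercRepro.ThmH PercRepro.PerFlat

variable {α : Type*} [DecidableEq α] {M : Matroid α} [M.Finite] {G : Finset α}

/-- Subadditivity of the rank. -/
theorem rkN_union_le_add (X Y : Finset α) : rkN M (X ∪ Y) ≤ rkN M X + rkN M Y := by
  have h := M.eRk_union_le_eRk_add_eRk (X : Set α) (Y : Set α)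
  rw [← Finset.coe_union, eRk_eq_rkN, eRk_eq_rkN, eRk_eq_rkN] at h
  exact_mod_cast h

/-- `lineFaceBound` is monotone in both arguments. -/
theorem lineFaceBound_mono {p p' r r' : ℕ} (hp : p ≤ p') (hr : r ≤ r') :
    lineFaceBound p r ≤ lineFaceBound p' r' := by
  unfold lineFaceBound
  have h1 := Nat.choose_le_choose 4 hr
  have h2 := Nat.choose_le_choose 3 hr
  have h3 := Nat.choose_le_choose 2 hr
  have h4 := Nat.choose_le_choose 2 hp
  have h5 := Nat.mul_le_mul hp h2
  have h6 := Nat.mul_le_mul h4 h3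
  omega

/-- `lineFaceBound p r > 0` for `r ≥ 4`. -/
theorem lineFaceBound_pos {p r : ℕ} (hr : 4 ≤ r) : 0 < lineFaceBound p r := by
  unfold lineFaceBound
  have := Nat.choose_pos hr
  omega

/-- **The two basis points are the only points of `Q′` on their line**: `Q′ ∩ cl {a, b} = {a, b}`. -/
theorem inter_clF_pair_eq_pair (hG : G ∈ flatsQ M (5 + 1)) (hd : (gr M \ G).card = 2) (hk : kColoops M G = 1)
    {B : Finset α} (hB : B ∈ thinMembers M 5 G) (hnP : ¬ bigP M G B) {z : α} (hz : z ∈ G \ clF M B) {a b : α}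
    (ha : a ∈ insert z B \ coloops M G) (hb : b ∈ insert z B \ coloops M G) (hab : a ≠ b) :
    (insert z B \ coloops M G) ∩ clF M {a, b} = {a, b} := by
  have hGg : G ⊆ gr M := (mem_flatsQ.1 hG).1
  have hQG : insert z B ⊆ G := Finset.insert_subset (Finset.mem_sdiff.1 hz).1 (subset_G_of_mem_thinMembers hB)
  have hQ'g : insert z B \ coloops M G ⊆ gr M := Finset.sdiff_subset.trans (hQG.trans hGg)
  have hab_cl : ({a, b} : Finset α) ⊆ clF M {a, b} := by
    apply subset_clF_of_subset_gr
    intro x hx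
    rw [Finset.mem_insert, Finset.mem_singleton] at hx
    rcases hx with rfl | rfl
    · exact hQ'g ha
    · exact hQ'g hb
  have hsub : ({a, b} : Finset α) ⊆ (insert z B \ coloops M G) ∩ clF M {a, b} := by
    intro x hx
    refine Finset.mem_inter.2 ⟨?_, hab_cl hx⟩
    rw [Finset.mem_insert, Finset.mem_singleton] at hx
    rcases hx with rfl | rfl
    · exact ha
    · exact hb
  have hind : M.Indep ((insert z B \ coloops M G : Finset α) : Set α) :=
    (indep_insert_of_basis_pair hG hd hk hB hnP hz).subset (by exact_mod_cast (Finset.sdiff_subset))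
  have h2 := card_inter_clF_pair_le_two_of_indep hind (a := a) (b := b)
  symm
  apply Finset.eq_of_subset_of_card_le hsub
  rw [Finset.card_pair hab]
  exact h2

/-- **The line targets of `(B, z)` for the off-line set `Y_O`** are targets, and their income is at least the line income:
`Σ_{j=5}^{d} C(d, j) · 3 / lineFaceBound (j + 2) (|Y_O| + 3) ≤ Σ_{T} vCap T / faceSum T` over
`T = Q ∪ (Y_D ∪ Y_O)`, `Y_D ⊆ W ∩ cl {a, b}`, `|Y_D| ≥ 5`. -/
theorem line_targets_subset_and_income (hG : G ∈ flatsQ M (5 + 1)) (hd : (gr M \ G).card = 2)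
    (hk : kColoops M G = 1) (hs : ∀ e ∈ gr M, ∀ f ∈ gr M, e ≠ f → rkN M {e, f} = 2)
    (hl : ∀ e ∈ gr M, M.Indep {e}) (hnf : fatClosures M 5 G 2 = ∅) {B : Finset α}
    (hB : B ∈ thinMembers M 5 G) (hnP : ¬ bigP M G B) {z : α} (hz : z ∈ G \ clF M B)
    (hl0 : loss M 5 G B z ≠ 0) {a b : α} (ha : a ∈ insert z B \ coloops M G)
    (hb : b ∈ insert z B \ coloops M G) (hab : a ≠ b) {YO : Finset α}
    (hYO : YO ⊆ (G \ insert z B) \ clF M {a, b}) (h3 : 3 ≤ YO.card)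
    (hrk : rkN M (((G \ insert z B) \ clF M {a, b}) \ YO) ≤ 1) :
    ((((G \ insert z B) ∩ clF M {a, b}).powerset.filter (fun YD => 5 ≤ YD.card)).image
        (fun YD => insert z B ∪ (YD ∪ YO))) ⊆ tgtSets M 5 G B z ∧
      ∑ j ∈ Finset.range (((G \ insert z B) ∩ clF M {a, b}).card + 1),
        ((((G \ insert z B) ∩ clF M {a, b}).card.choose j : ℕ) : ℚ) *
          (if 5 ≤ j then 3 / ((lineFaceBound (j + 2) (YO.card + 3) : ℕ) : ℚ) else 0) ≤
      ∑ T ∈ (((G \ insert z B) ∩ clF M {a, b}).powerset.filter (fun YD => 5 ≤ YD.card)).image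
        (fun YD => insert z B ∪ (YD ∪ YO)), vCap M G T / faceSum M G T := by
  have hd' : (gr M \ G).card ≤ 5 := by omega
  have hfat : (fatClosures M 5 G 2).card ≤ 1 := by
    rw [hnf, Finset.card_empty]
    exact zero_le_one
  have hGg : G ⊆ gr M := (mem_flatsQ.1 hG).1
  have hBG : B ⊆ G := subset_G_of_mem_thinMembers hB
  have hQG : insert z B ⊆ G := Finset.insert_subset (Finset.mem_sdiff.1 hz).1 hBG
  have hKB : coloops M G ⊆ B := coloops_subset_of_mem_thinMembers hG hd' hB
  set D : Finset α := (G \ insert z B) ∩ clF M {a, b} with hDdef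
  set Ds : Finset (Finset α) := D.powerset.filter (fun YD => 5 ≤ YD.card) with hDs
  set 𝒯 : Finset (Finset α) := Ds.image (fun YD => insert z B ∪ (YD ∪ YO)) with h𝒯
  have hYOne : YO.Nonempty := by
    rw [← Finset.card_pos]
    omega
  -- the targets
  have hmemD : ∀ YD ∈ Ds, YD ⊆ D := fun YD hYD => Finset.mem_powerset.1 (Finset.mem_filter.1 hYD).1
  have h5D : ∀ YD ∈ Ds, 5 ≤ YD.card := fun YD hYD => (Finset.mem_filter.1 hYD).2
  have hYDW : ∀ YD ∈ Ds, YD ⊆ G \ insert z B := fun YD hYD =>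
    (hmemD YD hYD).trans Finset.inter_subset_left
  have hYOW : YO ⊆ G \ insert z B := hYO.trans Finset.sdiff_subset
  have h𝒯sub : 𝒯 ⊆ tgtSets M 5 G B z := by
    intro T hT
    rw [h𝒯, Finset.mem_image] at hT
    obtain ⟨YD, hYD, rfl⟩ := hT
    rw [tgtSets_eq_image hG (mem_thinMembers.1 hB).1 hz, Finset.mem_image]
    refine ⟨YD ∪ YO, Finset.mem_filter.2 ⟨Finset.mem_powerset.2 (Finset.union_subset (hYDW YD hYD) hYOW),
      Finset.Nonempty.mono Finset.subset_union_right hYOne⟩, rfl⟩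
  -- injectivity: `Y_D` is recovered as `T ∩ D`
  have hinj : Set.InjOn (fun YD => insert z B ∪ (YD ∪ YO)) (Ds : Set (Finset α)) := by
    intro Y₁ hY₁ Y₂ hY₂ heq
    rw [Finset.mem_coe] at hY₁ hY₂
    have key : ∀ YD ∈ Ds, (insert z B ∪ (YD ∪ YO)) ∩ D = YD := by
      intro YD hYD
      ext x
      rw [Finset.mem_inter, Finset.mem_union, Finset.mem_union]
      constructor
      · rintro ⟨hx | hx | hx, hxD⟩
        · exfalso
          exact (Finset.mem_sdiff.1 (Finset.mem_inter.1 hxD).1).2 hx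
        · exact hx
        · exfalso
          exact (Finset.mem_sdiff.1 (hYO hx)).2 (Finset.mem_inter.1 hxD).2
      · intro hx
        exact ⟨Or.inr (Or.inl hx), hmemD YD hYD hx⟩
    have h1 := key Y₁ hY₁
    have h2 := key Y₂ hY₂
    simp only at heq
    rw [← h1, ← h2, heq]
  -- the per-target bound: `vCap = 1`, `faceSum ≤ (1/3) · lineFaceBound`
  have hterm : ∀ YD ∈ Ds, 3 / ((lineFaceBound (YD.card + 2) (YO.card + 3) : ℕ) : ℚ) ≤
      vCap M G (insert z B ∪ (YD ∪ YO)) / faceSum M G (insert z B ∪ (YD ∪ YO)) := by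
    intro YD hYD
    have hT : insert z B ∪ (YD ∪ YO) ∈ tgtSets M 5 G B z :=
      h𝒯sub (Finset.mem_image.2 ⟨YD, hYD, rfl⟩)
    have hTG : insert z B ∪ (YD ∪ YO) ⊆ G :=
      Finset.union_subset hQG (Finset.union_subset ((hYDW YD hYD).trans Finset.sdiff_subset)
        (hYOW.trans Finset.sdiff_subset))
    -- unloaded
    have hdl : dload M 5 G (bigP M G) (dshGT2 M 5 G) (insert z B ∪ (YD ∪ YO)) = 0 :=
      dload_eq_zero_of_line_target hG hd hk hs hl hfat hB hnP hz ha hb hab (hmemD YD hYD) (h5D YD hYD) hYO h3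
    -- the complement has rank `≤ 3`
    have hcomp : G \ (insert z B ∪ (YD ∪ YO)) ⊆ (D \ YD) ∪ (((G \ insert z B) \ clF M {a, b}) \ YO) := by
      intro x hx
      simp only [Finset.mem_sdiff, Finset.mem_union, not_or] at hx
      obtain ⟨hxG, hxQ, hxYD, hxYO⟩ := hx
      rw [Finset.mem_union, Finset.mem_sdiff, Finset.mem_sdiff, Finset.mem_sdiff, hDdef, Finset.mem_inter,
        Finset.mem_sdiff]
      by_cases hxl : x ∈ clF M {a, b}
      · exact Or.inl ⟨⟨⟨hxG, hxQ⟩, hxl⟩, hxYD⟩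
      · exact Or.inr ⟨⟨⟨hxG, hxQ⟩, hxl⟩, hxYO⟩
    have hrk3 : rkN M (G \ (insert z B ∪ (YD ∪ YO))) ≤ 3 := by
      refine le_trans (rkN_mono hcomp) ?_
      refine le_trans (rkN_union_le_add _ _) ?_
      have hD2 : rkN M (D \ YD) ≤ 2 := by
        refine le_trans (rkN_le_of_subset_clF' (Finset.sdiff_subset.trans Finset.inter_subset_right)) ?_
        exact le_trans (rkN_le_card _) Finset.card_le_two
      omega
    have hv : vCap M G (insert z B ∪ (YD ∪ YO)) = 1 := vCap_eq_one_of_rkN_sdiff_le_three hd hdl hrk3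
    -- the face sum
    have hpos := faceSum_pos_of_mem_tgtSets hG hd hk hB hnP hz hl0 hT
    have hfs := faceSum_le_third_mul_lineCount hG hd hk hnf hTG a b
    -- the line counts of the target
    have hQ'ℓ := inter_clF_pair_eq_pair hG hd hk hB hnP hz ha hb hab
    obtain ⟨-, hQ'5⟩ := rkN_insert_sdiff_coloops_eq_five hG hd hk hB hnP hz
    have hT'K : (insert z B ∪ (YD ∪ YO)) \ coloops M G = (insert z B \ coloops M G) ∪ (YD ∪ YO) := by
      ext x
      simp only [Finset.mem_sdiff, Finset.mem_union]
      constructor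
      · rintro ⟨hx | hx | hx, hxK⟩
        · exact Or.inl ⟨hx, hxK⟩
        · exact Or.inr (Or.inl hx)
        · exact Or.inr (Or.inr hx)
      · rintro (⟨hx, hxK⟩ | hx | hx)
        · exact ⟨Or.inl hx, hxK⟩
        · exact ⟨Or.inr (Or.inl hx),
            fun hxK => (Finset.mem_sdiff.1 (hYDW YD hYD hx)).2 (Finset.mem_insert_of_mem (hKB hxK))⟩
        · exact ⟨Or.inr (Or.inr hx),
            fun hxK => (Finset.mem_sdiff.1 (hYOW hx)).2 (Finset.mem_insert_of_mem (hKB hxK))⟩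
    have hcard_in : (((insert z B ∪ (YD ∪ YO)) \ coloops M G) ∩ clF M {a, b}).card ≤ YD.card + 2 := by
      rw [hT'K, Finset.union_inter_distrib_right, Finset.union_inter_distrib_right, hQ'ℓ]
      have hYOl : YO ∩ clF M {a, b} = ∅ := by
        rw [Finset.eq_empty_iff_forall_notMem]
        intro x hx
        exact (Finset.mem_sdiff.1 (hYO (Finset.mem_inter.1 hx).1)).2 (Finset.mem_inter.1 hx).2
      rw [hYOl, Finset.union_empty]
      refine le_trans (Finset.card_union_le _ _) ?_
      rw [Finset.card_pair hab]
      have := Finset.card_le_card (Finset.inter_subset_left : YD ∩ clF M {a, b} ⊆ YD)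
      omega
    have hcard_off : (((insert z B ∪ (YD ∪ YO)) \ coloops M G) \ clF M {a, b}).card ≤ YO.card + 3 := by
      rw [hT'K, Finset.union_sdiff_distrib, Finset.union_sdiff_distrib]
      have hYDl : YD \ clF M {a, b} = ∅ := by
        rw [Finset.eq_empty_iff_forall_notMem]
        intro x hx
        exact (Finset.mem_sdiff.1 hx).2 (Finset.mem_inter.1 (hmemD YD hYD (Finset.mem_sdiff.1 hx).1)).2
      rw [hYDl, Finset.empty_union]
      have hQ'off : ((insert z B \ coloops M G) \ clF M {a, b}).card = 3 := by
        have := Finset.card_sdiff_add_card_inter (insert z B \ coloops M G) (clF M {a, b})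
        rw [hQ'ℓ, Finset.card_pair hab, hQ'5] at this
        omega
      refine le_trans (Finset.card_union_le _ _) ?_
      rw [hQ'off]
      have := Finset.card_le_card (Finset.sdiff_subset : YO \ clF M {a, b} ⊆ YO)
      omega
    have hfs' : faceSum M G (insert z B ∪ (YD ∪ YO)) ≤
        1 / 3 * ((lineFaceBound (YD.card + 2) (YO.card + 3) : ℕ) : ℚ) := by
      refine le_trans hfs ?_
      apply mul_le_mul_of_nonneg_left _ (by norm_num)
      exact_mod_cast lineFaceBound_mono hcard_in hcard_off
    have hLpos : (0 : ℚ) < ((lineFaceBound (YD.card + 2) (YO.card + 3) : ℕ) : ℚ) := by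
      exact_mod_cast lineFaceBound_pos (by omega)
    rw [hv, div_le_div_iff₀ hLpos hpos]
    linarith
  -- the sum over the targets
  have hsum𝒯 : ∑ YD ∈ Ds, 3 / ((lineFaceBound (YD.card + 2) (YO.card + 3) : ℕ) : ℚ) ≤
      ∑ T ∈ 𝒯, vCap M G T / faceSum M G T := by
    rw [h𝒯, Finset.sum_image hinj]
    exact Finset.sum_le_sum hterm
  -- regroup by `|Y_D|`
  have hregroup : ∑ YD ∈ Ds, 3 / ((lineFaceBound (YD.card + 2) (YO.card + 3) : ℕ) : ℚ) =
      ∑ j ∈ Finset.range (D.card + 1), ((D.card.choose j : ℕ) : ℚ) *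
        (if 5 ≤ j then 3 / ((lineFaceBound (j + 2) (YO.card + 3) : ℕ) : ℚ) else 0) := by
    rw [hDs, Finset.sum_filter]
    rw [Finset.sum_powerset_apply_card (fun j => if 5 ≤ j then
      3 / ((lineFaceBound (j + 2) (YO.card + 3) : ℕ) : ℚ) else 0)]
    apply Finset.sum_congr rfl
    intro j _
    rw [nsmul_eq_mul]
  refine ⟨h𝒯sub, ?_⟩
  rw [← hregroup]
  exact hsum𝒯


/-- **THE LINE THEOREM**: a lossy basis pair of the non-fat cell `(2, 1)` with two basis points `a, b` on a line carrying
`d` further points of `W`, and an off-line set `Y_O ⊆ W ∖ cl {a, b}` with `|Y_O| ≥ 3` and `rk ((W ∖ cl {a, b}) ∖ Y_O) ≤ 1`,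
is fair as soon as `1 ≤ Σ_{j = 5}^{d} C(d, j) · 3 / lineFaceBound (j + 2) (|Y_O| + 3)`. -/
theorem basis_pair_fair_of_line (hG : G ∈ flatsQ M (5 + 1)) (hd : (gr M \ G).card = 2)
    (hk : kColoops M G = 1) (hs : ∀ e ∈ gr M, ∀ f ∈ gr M, e ≠ f → rkN M {e, f} = 2)
    (hl : ∀ e ∈ gr M, M.Indep {e}) (hnf : fatClosures M 5 G 2 = ∅) {B : Finset α}
    (hB : B ∈ thinMembers M 5 G) (hnP : ¬ bigP M G B) {z : α} (hz : z ∈ G \ clF M B)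
    (hl0 : loss M 5 G B z ≠ 0) {a b : α} (ha : a ∈ insert z B \ coloops M G)
    (hb : b ∈ insert z B \ coloops M G) (hab : a ≠ b) {YO : Finset α}
    (hYO : YO ⊆ (G \ insert z B) \ clF M {a, b}) (h3 : 3 ≤ YO.card)
    (hrk : rkN M (((G \ insert z B) \ clF M {a, b}) \ YO) ≤ 1)
    (hsum : 1 ≤ ∑ j ∈ Finset.range (((G \ insert z B) ∩ clF M {a, b}).card + 1),
      ((((G \ insert z B) ∩ clF M {a, b}).card.choose j : ℕ) : ℚ) *
        (if 5 ≤ j then 3 / ((lineFaceBound (j + 2) (YO.card + 3) : ℕ) : ℚ) else 0)) :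
    loss M 5 G B z ≤ rhoL M 5 G B z * lossIncomeH M 5 G (bigP M G) (dshGT2 M 5 G) B z := by
  have hfat : (fatClosures M 5 G 2).card ≤ 1 := by
    rw [hnf, Finset.card_empty]
    exact zero_le_one
  obtain ⟨hsub, hinc⟩ := line_targets_subset_and_income hG hd hk hs hl hnf hB hnP hz hl0 ha hb hab hYO h3 hrk
  exact basis_pair_fair_of_vCap_face_sum_subfamily hG hd hk hs hl hfat hB hnP hz hl0 hsub (hsum.trans hinc)

end PercRepro.Shadow
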